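import Summits.ResolutionOfSingularities.ResolutionOfSingularities.Theorems.UniversalCellsMatroidCellResResidueWitnessChart
import HarnessLib

/-!
# The chart `D(a₀₀)` of the complete-quadrilateral Γ-scheme has dimension ≥ 4 (crux `UniversalCells.MatroidCellRes`)

Fourth of five files of the witness for the residue stub (N) of crux stmt-ResolutionOfSingularities-15230
(`UniversalCells.MatroidCellRes`, line `birth`). With `K` a field, `2 ≠ 0`,
`A₀ = [[1,1,1,0],[1,1,0,1],[1,0,1,1]]`, `Γ = {u | x_u(A₀) = 0}` and the chart ring
`L = (K[A] ⧸ (x_u : u ∈ Γ))[1/a₀₀]` (files `…ResidueWitnessMinors/Cone/Chart.lean`):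

* `exists_ringHom_chart_torus` — the torus of points `A₀ · diag(1, t₀, t₁, t₂)` gives a ring map
  `g₃ : L → K[t₀, t₁, t₂]`;
* `bot_lt_ker_torus`, `ker_torus_lt_ker_spec₂`, `ker_spec₂_lt_ker_spec₁`, `ker_spec₁_lt_ker_spec₀` —
  with the successive specialisations `t₂ = 1`, `t₁ = 1`, `t₀ = 1` the kernels form a strict chain
  `⊥ < ker g₃ < ker g₂ < ker g₁ < ker g₀` (witnesses `a₀₁ - a₁₁`, `a₁₃ - a₁₀`, `a₀₂ - a₀₀`, `a₀₁ - a₀₀`);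
* `four_le_ringKrullDim_chart`, `not_topologicalKrullDim_chart_le_three` — hence `dim L ≥ 4`
  (five primes; `L` is a domain by `isDomain_chart`), i.e. `Spec L` does not have dimension `≤ 3`.

No definition and no notation is declared. Folklore throughout.
-/

noncomputable section

-- single-problem summit: the doubled namespace component `ResolutionOfSingularities` is forced
set_option linter.dupNamespace false

open MvPolynomial AlgebraicGeometry Literature.AlgebraicGeometry.Resolution

namespace Summit.ResolutionOfSingularities.ResolutionOfSingularities.Theorems.MatroidCellRes

variable {K : Type} [Field K]

/-! ## The chart has dimension `≥ 4` -/

/-- **A torus of points of the chart**: the evaluation `A ↦ A₀ · diag(1, t₀, t₁, t₂)` with values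
in `K[t₀, t₁, t₂]` factors through the chart ring. [folklore] -/
theorem exists_ringHom_chart_torus (h2 : (2 : K) ≠ 0) :
    ∃ ψ : (Localization.Away (Ideal.Quotient.mk (HuGamma.ideal K 4 {u | aeval (fun ij : Fin 3 × Fin 4 =>
          (![![(1 : K), 1, 1, 0], ![1, 1, 0, 1], ![1, 0, 1, 1]] : Fin 3 → Fin 4 → K) ij.1 ij.2)
            (HuGamma.minor K 4 u) = 0}) (X (0, 0)))) →+* MvPolynomial (Fin 3) K,
      ∀ f, ψ (algebraMap (HuGamma.ring K 4 {u | aeval (fun ij : Fin 3 × Fin 4 =>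
          (![![(1 : K), 1, 1, 0], ![1, 1, 0, 1], ![1, 0, 1, 1]] : Fin 3 → Fin 4 → K) ij.1 ij.2)
            (HuGamma.minor K 4 u) = 0}) (Localization.Away (Ideal.Quotient.mk (HuGamma.ideal K 4 {u | aeval (fun ij : Fin 3 × Fin 4 =>
          (![![(1 : K), 1, 1, 0], ![1, 1, 0, 1], ![1, 0, 1, 1]] : Fin 3 → Fin 4 → K) ij.1 ij.2)
            (HuGamma.minor K 4 u) = 0}) (X (0, 0)))) (Ideal.Quotient.mk (HuGamma.ideal K 4 {u | aeval (fun ij : Fin 3 × Fin 4 =>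
          (![![(1 : K), 1, 1, 0], ![1, 1, 0, 1], ![1, 0, 1, 1]] : Fin 3 → Fin 4 → K) ij.1 ij.2)
            (HuGamma.minor K 4 u) = 0}) f)) =
        aeval (fun ij : Fin 3 × Fin 4 => (![![(1 : MvPolynomial (Fin 3) K), X 0, X 1, 0], ![1, X 0, 0, X 2], ![1, 0, X 1, X 2]] :
            Fin 3 → Fin 4 → MvPolynomial (Fin 3) K) ij.1 ij.2) f :=
  exists_ringHom_away (S := MvPolynomial (Fin 3) K) h2 _
    (by simp) (by simp) (by simp) (by simp) (by simp) (by simp) (by simp)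

/-- A difference `X i - 1` (or `1 - X i`) is non-zero in a polynomial ring over a field
(evaluate at `0`). [folklore] -/
theorem X_sub_one_ne_zero (i : Fin 3) : (X i - 1 : MvPolynomial (Fin 3) K) ≠ 0 := by
  intro h
  have := congrArg (eval fun _ => (0 : K)) h
  simp at this

/-- Kernels grow along a composition. [folklore] -/
theorem ker_le_ker_comp {A B C : Type*} [CommRing A] [CommRing B] [CommRing C] (g : A →+* B)
    (s : B →+* C) : RingHom.ker g ≤ RingHom.ker (s.comp g) := fun x hx => by
  rw [RingHom.mem_ker] at hx ⊢
  rw [RingHom.comp_apply, hx, map_zero]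

/-- Values of a specialisation `K[t] → K[t]` on the variables. [folklore] -/
theorem aeval_toRingHom_X (w : Fin 3 → MvPolynomial (Fin 3) K) (i : Fin 3) :
    (aeval w : MvPolynomial (Fin 3) K →ₐ[K] MvPolynomial (Fin 3) K).toRingHom (X i) = w i := by
  rw [AlgHom.toRingHom_eq_coe, RingHom.coe_coe, aeval_X]

/-- Step 0 of the chain: `⊥ < ker g₃` — `a₀₁ - a₁₁ ↦ t₀ - t₀ = 0`, but `a₀₁ ≠ a₁₁` in the chart
(evaluate at `[[1,1,1,0],[2,2,0,2],[1,0,1,1]]`). [folklore] -/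
theorem bot_lt_ker_torus (h2 : (2 : K) ≠ 0) (ψ : (Localization.Away (Ideal.Quotient.mk (HuGamma.ideal K 4 {u | aeval (fun ij : Fin 3 × Fin 4 =>
          (![![(1 : K), 1, 1, 0], ![1, 1, 0, 1], ![1, 0, 1, 1]] : Fin 3 → Fin 4 → K) ij.1 ij.2)
            (HuGamma.minor K 4 u) = 0}) (X (0, 0)))) →+* MvPolynomial (Fin 3) K)
    (hψ : ∀ f, ψ (algebraMap (HuGamma.ring K 4 {u | aeval (fun ij : Fin 3 × Fin 4 =>
          (![![(1 : K), 1, 1, 0], ![1, 1, 0, 1], ![1, 0, 1, 1]] : Fin 3 → Fin 4 → K) ij.1 ij.2)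
            (HuGamma.minor K 4 u) = 0}) (Localization.Away (Ideal.Quotient.mk (HuGamma.ideal K 4 {u | aeval (fun ij : Fin 3 × Fin 4 =>
          (![![(1 : K), 1, 1, 0], ![1, 1, 0, 1], ![1, 0, 1, 1]] : Fin 3 → Fin 4 → K) ij.1 ij.2)
            (HuGamma.minor K 4 u) = 0}) (X (0, 0)))) (Ideal.Quotient.mk (HuGamma.ideal K 4 {u | aeval (fun ij : Fin 3 × Fin 4 =>
          (![![(1 : K), 1, 1, 0], ![1, 1, 0, 1], ![1, 0, 1, 1]] : Fin 3 → Fin 4 → K) ij.1 ij.2)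
            (HuGamma.minor K 4 u) = 0}) f)) =
      aeval (fun ij : Fin 3 × Fin 4 => (![![(1 : MvPolynomial (Fin 3) K), X 0, X 1, 0], ![1, X 0, 0, X 2], ![1, 0, X 1, X 2]] :
            Fin 3 → Fin 4 → MvPolynomial (Fin 3) K) ij.1 ij.2) f) :
    (⊥ : Ideal (Localization.Away (Ideal.Quotient.mk (HuGamma.ideal K 4 {u | aeval (fun ij : Fin 3 × Fin 4 =>
          (![![(1 : K), 1, 1, 0], ![1, 1, 0, 1], ![1, 0, 1, 1]] : Fin 3 → Fin 4 → K) ij.1 ij.2)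
            (HuGamma.minor K 4 u) = 0}) (X (0, 0))))) < RingHom.ker ψ := by
  refine lt_of_le_of_ne bot_le fun h => ?_
  have hz : algebraMap (HuGamma.ring K 4 {u | aeval (fun ij : Fin 3 × Fin 4 =>
          (![![(1 : K), 1, 1, 0], ![1, 1, 0, 1], ![1, 0, 1, 1]] : Fin 3 → Fin 4 → K) ij.1 ij.2)
            (HuGamma.minor K 4 u) = 0}) (Localization.Away (Ideal.Quotient.mk (HuGamma.ideal K 4 {u | aeval (fun ij : Fin 3 × Fin 4 =>
          (![![(1 : K), 1, 1, 0], ![1, 1, 0, 1], ![1, 0, 1, 1]] : Fin 3 → Fin 4 → K) ij.1 ij.2)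
            (HuGamma.minor K 4 u) = 0}) (X (0, 0)))) (Ideal.Quotient.mk (HuGamma.ideal K 4 {u | aeval (fun ij : Fin 3 × Fin 4 =>
          (![![(1 : K), 1, 1, 0], ![1, 1, 0, 1], ![1, 0, 1, 1]] : Fin 3 → Fin 4 → K) ij.1 ij.2)
            (HuGamma.minor K 4 u) = 0}) (X (0, 1))) -
      algebraMap (HuGamma.ring K 4 {u | aeval (fun ij : Fin 3 × Fin 4 =>
          (![![(1 : K), 1, 1, 0], ![1, 1, 0, 1], ![1, 0, 1, 1]] : Fin 3 → Fin 4 → K) ij.1 ij.2)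
            (HuGamma.minor K 4 u) = 0}) (Localization.Away (Ideal.Quotient.mk (HuGamma.ideal K 4 {u | aeval (fun ij : Fin 3 × Fin 4 =>
          (![![(1 : K), 1, 1, 0], ![1, 1, 0, 1], ![1, 0, 1, 1]] : Fin 3 → Fin 4 → K) ij.1 ij.2)
            (HuGamma.minor K 4 u) = 0}) (X (0, 0)))) (Ideal.Quotient.mk (HuGamma.ideal K 4 {u | aeval (fun ij : Fin 3 × Fin 4 =>
          (![![(1 : K), 1, 1, 0], ![1, 1, 0, 1], ![1, 0, 1, 1]] : Fin 3 → Fin 4 → K) ij.1 ij.2)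
            (HuGamma.minor K 4 u) = 0}) (X (1, 1))) ∈ RingHom.ker ψ := by
    rw [RingHom.mem_ker, map_sub, hψ, hψ, aeval_X, aeval_X]
    simp
  rw [← h, Ideal.mem_bot, sub_eq_zero] at hz
  obtain ⟨χ, hχ⟩ := exists_ringHom_away (S := K) h2
    (![![(1 : K), 1, 1, 0], ![2, 2, 0, 2], ![1, 0, 1, 1]] : Fin 3 → Fin 4 → K)
    (by simp) (by simp) (by simp) (by simp) (by simp) (by simp) (by simp)
  have := congrArg χ hz
  rw [hχ, hχ, aeval_X, aeval_X] at this
  simp only [Matrix.cons_val] at this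
  exact one_ne_zero (by linear_combination -this : (1 : K) = 0)

/-- Step 1: `ker g₃ < ker g₂` (`g₂ = (t₂ ↦ 1) ∘ g₃`) — `a₁₃ - a₁₀ ↦ t₂ - 1 ≠ 0`, `↦ 0` after
`t₂ = 1`. [folklore] -/
theorem ker_torus_lt_ker_spec₂ (ψ : (Localization.Away (Ideal.Quotient.mk (HuGamma.ideal K 4 {u | aeval (fun ij : Fin 3 × Fin 4 =>
          (![![(1 : K), 1, 1, 0], ![1, 1, 0, 1], ![1, 0, 1, 1]] : Fin 3 → Fin 4 → K) ij.1 ij.2)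
            (HuGamma.minor K 4 u) = 0}) (X (0, 0)))) →+* MvPolynomial (Fin 3) K)
    (hψ : ∀ f, ψ (algebraMap (HuGamma.ring K 4 {u | aeval (fun ij : Fin 3 × Fin 4 =>
          (![![(1 : K), 1, 1, 0], ![1, 1, 0, 1], ![1, 0, 1, 1]] : Fin 3 → Fin 4 → K) ij.1 ij.2)
            (HuGamma.minor K 4 u) = 0}) (Localization.Away (Ideal.Quotient.mk (HuGamma.ideal K 4 {u | aeval (fun ij : Fin 3 × Fin 4 =>
          (![![(1 : K), 1, 1, 0], ![1, 1, 0, 1], ![1, 0, 1, 1]] : Fin 3 → Fin 4 → K) ij.1 ij.2)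
            (HuGamma.minor K 4 u) = 0}) (X (0, 0)))) (Ideal.Quotient.mk (HuGamma.ideal K 4 {u | aeval (fun ij : Fin 3 × Fin 4 =>
          (![![(1 : K), 1, 1, 0], ![1, 1, 0, 1], ![1, 0, 1, 1]] : Fin 3 → Fin 4 → K) ij.1 ij.2)
            (HuGamma.minor K 4 u) = 0}) f)) =
      aeval (fun ij : Fin 3 × Fin 4 => (![![(1 : MvPolynomial (Fin 3) K), X 0, X 1, 0], ![1, X 0, 0, X 2], ![1, 0, X 1, X 2]] :
            Fin 3 → Fin 4 → MvPolynomial (Fin 3) K) ij.1 ij.2) f) :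
    RingHom.ker ψ < RingHom.ker (((aeval ![X 0, X 1, 1] : MvPolynomial (Fin 3) K →ₐ[K] MvPolynomial (Fin 3) K).toRingHom).comp ψ) := by
  refine lt_of_le_of_ne (ker_le_ker_comp _ _) fun h => ?_
  have hz : algebraMap (HuGamma.ring K 4 {u | aeval (fun ij : Fin 3 × Fin 4 =>
          (![![(1 : K), 1, 1, 0], ![1, 1, 0, 1], ![1, 0, 1, 1]] : Fin 3 → Fin 4 → K) ij.1 ij.2)
            (HuGamma.minor K 4 u) = 0}) (Localization.Away (Ideal.Quotient.mk (HuGamma.ideal K 4 {u | aeval (fun ij : Fin 3 × Fin 4 =>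
          (![![(1 : K), 1, 1, 0], ![1, 1, 0, 1], ![1, 0, 1, 1]] : Fin 3 → Fin 4 → K) ij.1 ij.2)
            (HuGamma.minor K 4 u) = 0}) (X (0, 0)))) (Ideal.Quotient.mk (HuGamma.ideal K 4 {u | aeval (fun ij : Fin 3 × Fin 4 =>
          (![![(1 : K), 1, 1, 0], ![1, 1, 0, 1], ![1, 0, 1, 1]] : Fin 3 → Fin 4 → K) ij.1 ij.2)
            (HuGamma.minor K 4 u) = 0}) (X (1, 3))) -
      algebraMap (HuGamma.ring K 4 {u | aeval (fun ij : Fin 3 × Fin 4 =>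
          (![![(1 : K), 1, 1, 0], ![1, 1, 0, 1], ![1, 0, 1, 1]] : Fin 3 → Fin 4 → K) ij.1 ij.2)
            (HuGamma.minor K 4 u) = 0}) (Localization.Away (Ideal.Quotient.mk (HuGamma.ideal K 4 {u | aeval (fun ij : Fin 3 × Fin 4 =>
          (![![(1 : K), 1, 1, 0], ![1, 1, 0, 1], ![1, 0, 1, 1]] : Fin 3 → Fin 4 → K) ij.1 ij.2)
            (HuGamma.minor K 4 u) = 0}) (X (0, 0)))) (Ideal.Quotient.mk (HuGamma.ideal K 4 {u | aeval (fun ij : Fin 3 × Fin 4 =>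
          (![![(1 : K), 1, 1, 0], ![1, 1, 0, 1], ![1, 0, 1, 1]] : Fin 3 → Fin 4 → K) ij.1 ij.2)
            (HuGamma.minor K 4 u) = 0}) (X (1, 0))) ∈ RingHom.ker (((aeval ![X 0, X 1, 1] : MvPolynomial (Fin 3) K →ₐ[K] MvPolynomial (Fin 3) K).toRingHom).comp ψ) := by
    rw [RingHom.mem_ker, RingHom.comp_apply, map_sub, hψ, hψ, aeval_X, aeval_X]
    simp only [Matrix.cons_val, map_sub, map_one, aeval_toRingHom_X, sub_self]
  rw [← h, RingHom.mem_ker, map_sub, hψ, hψ, aeval_X, aeval_X] at hz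
  simp only [Matrix.cons_val] at hz
  exact X_sub_one_ne_zero 2 hz

/-- Step 2: `ker g₂ < ker g₁` (`g₁ = (t₁ ↦ 1) ∘ g₂`) — `a₀₂ - a₀₀ ↦ t₁ - 1 ≠ 0`, `↦ 0` after
`t₁ = 1`. [folklore] -/
theorem ker_spec₂_lt_ker_spec₁ (ψ : (Localization.Away (Ideal.Quotient.mk (HuGamma.ideal K 4 {u | aeval (fun ij : Fin 3 × Fin 4 =>
          (![![(1 : K), 1, 1, 0], ![1, 1, 0, 1], ![1, 0, 1, 1]] : Fin 3 → Fin 4 → K) ij.1 ij.2)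
            (HuGamma.minor K 4 u) = 0}) (X (0, 0)))) →+* MvPolynomial (Fin 3) K)
    (hψ : ∀ f, ψ (algebraMap (HuGamma.ring K 4 {u | aeval (fun ij : Fin 3 × Fin 4 =>
          (![![(1 : K), 1, 1, 0], ![1, 1, 0, 1], ![1, 0, 1, 1]] : Fin 3 → Fin 4 → K) ij.1 ij.2)
            (HuGamma.minor K 4 u) = 0}) (Localization.Away (Ideal.Quotient.mk (HuGamma.ideal K 4 {u | aeval (fun ij : Fin 3 × Fin 4 =>
          (![![(1 : K), 1, 1, 0], ![1, 1, 0, 1], ![1, 0, 1, 1]] : Fin 3 → Fin 4 → K) ij.1 ij.2)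
            (HuGamma.minor K 4 u) = 0}) (X (0, 0)))) (Ideal.Quotient.mk (HuGamma.ideal K 4 {u | aeval (fun ij : Fin 3 × Fin 4 =>
          (![![(1 : K), 1, 1, 0], ![1, 1, 0, 1], ![1, 0, 1, 1]] : Fin 3 → Fin 4 → K) ij.1 ij.2)
            (HuGamma.minor K 4 u) = 0}) f)) =
      aeval (fun ij : Fin 3 × Fin 4 => (![![(1 : MvPolynomial (Fin 3) K), X 0, X 1, 0], ![1, X 0, 0, X 2], ![1, 0, X 1, X 2]] :
            Fin 3 → Fin 4 → MvPolynomial (Fin 3) K) ij.1 ij.2) f) :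
    RingHom.ker (((aeval ![X 0, X 1, 1] : MvPolynomial (Fin 3) K →ₐ[K] MvPolynomial (Fin 3) K).toRingHom).comp ψ) < RingHom.ker (((aeval ![X 0, 1, X 2] : MvPolynomial (Fin 3) K →ₐ[K] MvPolynomial (Fin 3) K).toRingHom).comp (((aeval ![X 0, X 1, 1] : MvPolynomial (Fin 3) K →ₐ[K] MvPolynomial (Fin 3) K).toRingHom).comp ψ)) := by
  refine lt_of_le_of_ne (ker_le_ker_comp _ _) fun h => ?_
  have hz : algebraMap (HuGamma.ring K 4 {u | aeval (fun ij : Fin 3 × Fin 4 =>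
          (![![(1 : K), 1, 1, 0], ![1, 1, 0, 1], ![1, 0, 1, 1]] : Fin 3 → Fin 4 → K) ij.1 ij.2)
            (HuGamma.minor K 4 u) = 0}) (Localization.Away (Ideal.Quotient.mk (HuGamma.ideal K 4 {u | aeval (fun ij : Fin 3 × Fin 4 =>
          (![![(1 : K), 1, 1, 0], ![1, 1, 0, 1], ![1, 0, 1, 1]] : Fin 3 → Fin 4 → K) ij.1 ij.2)
            (HuGamma.minor K 4 u) = 0}) (X (0, 0)))) (Ideal.Quotient.mk (HuGamma.ideal K 4 {u | aeval (fun ij : Fin 3 × Fin 4 =>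
          (![![(1 : K), 1, 1, 0], ![1, 1, 0, 1], ![1, 0, 1, 1]] : Fin 3 → Fin 4 → K) ij.1 ij.2)
            (HuGamma.minor K 4 u) = 0}) (X (0, 2))) -
      algebraMap (HuGamma.ring K 4 {u | aeval (fun ij : Fin 3 × Fin 4 =>
          (![![(1 : K), 1, 1, 0], ![1, 1, 0, 1], ![1, 0, 1, 1]] : Fin 3 → Fin 4 → K) ij.1 ij.2)
            (HuGamma.minor K 4 u) = 0}) (Localization.Away (Ideal.Quotient.mk (HuGamma.ideal K 4 {u | aeval (fun ij : Fin 3 × Fin 4 =>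
          (![![(1 : K), 1, 1, 0], ![1, 1, 0, 1], ![1, 0, 1, 1]] : Fin 3 → Fin 4 → K) ij.1 ij.2)
            (HuGamma.minor K 4 u) = 0}) (X (0, 0)))) (Ideal.Quotient.mk (HuGamma.ideal K 4 {u | aeval (fun ij : Fin 3 × Fin 4 =>
          (![![(1 : K), 1, 1, 0], ![1, 1, 0, 1], ![1, 0, 1, 1]] : Fin 3 → Fin 4 → K) ij.1 ij.2)
            (HuGamma.minor K 4 u) = 0}) (X (0, 0))) ∈
      RingHom.ker (((aeval ![X 0, 1, X 2] : MvPolynomial (Fin 3) K →ₐ[K] MvPolynomial (Fin 3) K).toRingHom).comp (((aeval ![X 0, X 1, 1] : MvPolynomial (Fin 3) K →ₐ[K] MvPolynomial (Fin 3) K).toRingHom).comp ψ)) := by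
    rw [RingHom.mem_ker, RingHom.comp_apply, RingHom.comp_apply, map_sub, hψ, hψ, aeval_X, aeval_X]
    simp only [Matrix.cons_val, map_sub, map_one, aeval_toRingHom_X, sub_self]
  rw [← h, RingHom.mem_ker, RingHom.comp_apply, map_sub, hψ, hψ, aeval_X, aeval_X] at hz
  simp only [Matrix.cons_val, map_sub, map_one, aeval_toRingHom_X] at hz
  exact X_sub_one_ne_zero 1 hz

/-- Step 3: `ker g₁ < ker g₀` (`g₀ = (t₀ ↦ 1) ∘ g₁`) — `a₀₁ - a₀₀ ↦ t₀ - 1 ≠ 0`, `↦ 0` after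
`t₀ = 1`. [folklore] -/
theorem ker_spec₁_lt_ker_spec₀ (ψ : (Localization.Away (Ideal.Quotient.mk (HuGamma.ideal K 4 {u | aeval (fun ij : Fin 3 × Fin 4 =>
          (![![(1 : K), 1, 1, 0], ![1, 1, 0, 1], ![1, 0, 1, 1]] : Fin 3 → Fin 4 → K) ij.1 ij.2)
            (HuGamma.minor K 4 u) = 0}) (X (0, 0)))) →+* MvPolynomial (Fin 3) K)
    (hψ : ∀ f, ψ (algebraMap (HuGamma.ring K 4 {u | aeval (fun ij : Fin 3 × Fin 4 =>
          (![![(1 : K), 1, 1, 0], ![1, 1, 0, 1], ![1, 0, 1, 1]] : Fin 3 → Fin 4 → K) ij.1 ij.2)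
            (HuGamma.minor K 4 u) = 0}) (Localization.Away (Ideal.Quotient.mk (HuGamma.ideal K 4 {u | aeval (fun ij : Fin 3 × Fin 4 =>
          (![![(1 : K), 1, 1, 0], ![1, 1, 0, 1], ![1, 0, 1, 1]] : Fin 3 → Fin 4 → K) ij.1 ij.2)
            (HuGamma.minor K 4 u) = 0}) (X (0, 0)))) (Ideal.Quotient.mk (HuGamma.ideal K 4 {u | aeval (fun ij : Fin 3 × Fin 4 =>
          (![![(1 : K), 1, 1, 0], ![1, 1, 0, 1], ![1, 0, 1, 1]] : Fin 3 → Fin 4 → K) ij.1 ij.2)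
            (HuGamma.minor K 4 u) = 0}) f)) =
      aeval (fun ij : Fin 3 × Fin 4 => (![![(1 : MvPolynomial (Fin 3) K), X 0, X 1, 0], ![1, X 0, 0, X 2], ![1, 0, X 1, X 2]] :
            Fin 3 → Fin 4 → MvPolynomial (Fin 3) K) ij.1 ij.2) f) :
    RingHom.ker (((aeval ![X 0, 1, X 2] : MvPolynomial (Fin 3) K →ₐ[K] MvPolynomial (Fin 3) K).toRingHom).comp (((aeval ![X 0, X 1, 1] : MvPolynomial (Fin 3) K →ₐ[K] MvPolynomial (Fin 3) K).toRingHom).comp ψ)) <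
      RingHom.ker (((aeval ![1, X 1, X 2] : MvPolynomial (Fin 3) K →ₐ[K] MvPolynomial (Fin 3) K).toRingHom).comp (((aeval ![X 0, 1, X 2] : MvPolynomial (Fin 3) K →ₐ[K] MvPolynomial (Fin 3) K).toRingHom).comp (((aeval ![X 0, X 1, 1] : MvPolynomial (Fin 3) K →ₐ[K] MvPolynomial (Fin 3) K).toRingHom).comp ψ))) := by
  refine lt_of_le_of_ne (ker_le_ker_comp _ _) fun h => ?_
  have hz : algebraMap (HuGamma.ring K 4 {u | aeval (fun ij : Fin 3 × Fin 4 =>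
          (![![(1 : K), 1, 1, 0], ![1, 1, 0, 1], ![1, 0, 1, 1]] : Fin 3 → Fin 4 → K) ij.1 ij.2)
            (HuGamma.minor K 4 u) = 0}) (Localization.Away (Ideal.Quotient.mk (HuGamma.ideal K 4 {u | aeval (fun ij : Fin 3 × Fin 4 =>
          (![![(1 : K), 1, 1, 0], ![1, 1, 0, 1], ![1, 0, 1, 1]] : Fin 3 → Fin 4 → K) ij.1 ij.2)
            (HuGamma.minor K 4 u) = 0}) (X (0, 0)))) (Ideal.Quotient.mk (HuGamma.ideal K 4 {u | aeval (fun ij : Fin 3 × Fin 4 =>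
          (![![(1 : K), 1, 1, 0], ![1, 1, 0, 1], ![1, 0, 1, 1]] : Fin 3 → Fin 4 → K) ij.1 ij.2)
            (HuGamma.minor K 4 u) = 0}) (X (0, 1))) -
      algebraMap (HuGamma.ring K 4 {u | aeval (fun ij : Fin 3 × Fin 4 =>
          (![![(1 : K), 1, 1, 0], ![1, 1, 0, 1], ![1, 0, 1, 1]] : Fin 3 → Fin 4 → K) ij.1 ij.2)
            (HuGamma.minor K 4 u) = 0}) (Localization.Away (Ideal.Quotient.mk (HuGamma.ideal K 4 {u | aeval (fun ij : Fin 3 × Fin 4 =>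
          (![![(1 : K), 1, 1, 0], ![1, 1, 0, 1], ![1, 0, 1, 1]] : Fin 3 → Fin 4 → K) ij.1 ij.2)
            (HuGamma.minor K 4 u) = 0}) (X (0, 0)))) (Ideal.Quotient.mk (HuGamma.ideal K 4 {u | aeval (fun ij : Fin 3 × Fin 4 =>
          (![![(1 : K), 1, 1, 0], ![1, 1, 0, 1], ![1, 0, 1, 1]] : Fin 3 → Fin 4 → K) ij.1 ij.2)
            (HuGamma.minor K 4 u) = 0}) (X (0, 0))) ∈
      RingHom.ker (((aeval ![1, X 1, X 2] : MvPolynomial (Fin 3) K →ₐ[K] MvPolynomial (Fin 3) K).toRingHom).comp (((aeval ![X 0, 1, X 2] : MvPolynomial (Fin 3) K →ₐ[K] MvPolynomial (Fin 3) K).toRingHom).comp (((aeval ![X 0, X 1, 1] : MvPolynomial (Fin 3) K →ₐ[K] MvPolynomial (Fin 3) K).toRingHom).comp ψ))) := by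
    rw [RingHom.mem_ker, RingHom.comp_apply, RingHom.comp_apply, RingHom.comp_apply, map_sub, hψ,
      hψ, aeval_X, aeval_X]
    simp only [Matrix.cons_val, map_sub, map_one, aeval_toRingHom_X, sub_self]
  rw [← h, RingHom.mem_ker, RingHom.comp_apply, RingHom.comp_apply, map_sub, hψ, hψ, aeval_X,
    aeval_X] at hz
  simp only [Matrix.cons_val, map_sub, map_one, aeval_toRingHom_X] at hz
  exact X_sub_one_ne_zero 0 hz

/-- **The chart ring has Krull dimension `≥ 4`**: with the torus evaluation `g₃` and its successive
specialisations `g₂, g₁, g₀` (`t₂ = 1`, then `t₁ = 1`, then `t₀ = 1`), the kernels are primes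
(the targets are domains) and `⊥ < ker g₃ < ker g₂ < ker g₁ < ker g₀` is a chain of five primes of
the chart ring (a domain: `isDomain_chart`). [folklore] -/
theorem four_le_ringKrullDim_chart (h2 : (2 : K) ≠ 0) :
    (4 : WithBot ℕ∞) ≤ ringKrullDim (Localization.Away (Ideal.Quotient.mk (HuGamma.ideal K 4 {u | aeval (fun ij : Fin 3 × Fin 4 =>
          (![![(1 : K), 1, 1, 0], ![1, 1, 0, 1], ![1, 0, 1, 1]] : Fin 3 → Fin 4 → K) ij.1 ij.2)
            (HuGamma.minor K 4 u) = 0}) (X (0, 0)))) := by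
  haveI := isDomain_chart (K := K) h2
  obtain ⟨ψ, hψ⟩ := exists_ringHom_chart_torus (K := K) h2
  have lt₀ := bot_lt_ker_torus h2 ψ hψ
  have lt₁ := ker_torus_lt_ker_spec₂ ψ hψ
  have lt₂ := ker_spec₂_lt_ker_spec₁ ψ hψ
  have lt₃ := ker_spec₁_lt_ker_spec₀ ψ hψ
  haveI ib : (⊥ : Ideal (Localization.Away (Ideal.Quotient.mk (HuGamma.ideal K 4 {u | aeval (fun ij : Fin 3 × Fin 4 =>
          (![![(1 : K), 1, 1, 0], ![1, 1, 0, 1], ![1, 0, 1, 1]] : Fin 3 → Fin 4 → K) ij.1 ij.2)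
            (HuGamma.minor K 4 u) = 0}) (X (0, 0))))).IsPrime := Ideal.isPrime_bot
  haveI i₃ : (RingHom.ker ψ).IsPrime := RingHom.ker_isPrime ψ
  haveI i₂ : (RingHom.ker (((aeval ![X 0, X 1, 1] : MvPolynomial (Fin 3) K →ₐ[K] MvPolynomial (Fin 3) K).toRingHom).comp ψ)).IsPrime := RingHom.ker_isPrime _
  haveI i₁ : (RingHom.ker (((aeval ![X 0, 1, X 2] : MvPolynomial (Fin 3) K →ₐ[K] MvPolynomial (Fin 3) K).toRingHom).comp (((aeval ![X 0, X 1, 1] : MvPolynomial (Fin 3) K →ₐ[K] MvPolynomial (Fin 3) K).toRingHom).comp ψ))).IsPrime := RingHom.ker_isPrime _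
  haveI i₀ : (RingHom.ker (((aeval ![1, X 1, X 2] : MvPolynomial (Fin 3) K →ₐ[K] MvPolynomial (Fin 3) K).toRingHom).comp (((aeval ![X 0, 1, X 2] : MvPolynomial (Fin 3) K →ₐ[K] MvPolynomial (Fin 3) K).toRingHom).comp (((aeval ![X 0, X 1, 1] : MvPolynomial (Fin 3) K →ₐ[K] MvPolynomial (Fin 3) K).toRingHom).comp ψ)))).IsPrime := RingHom.ker_isPrime _
  let c : LTSeries (PrimeSpectrum (Localization.Away (Ideal.Quotient.mk (HuGamma.ideal K 4 {u | aeval (fun ij : Fin 3 × Fin 4 =>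
          (![![(1 : K), 1, 1, 0], ![1, 1, 0, 1], ![1, 0, 1, 1]] : Fin 3 → Fin 4 → K) ij.1 ij.2)
            (HuGamma.minor K 4 u) = 0}) (X (0, 0))))) :=
    ⟨4, ![⟨⊥, ib⟩, ⟨_, i₃⟩, ⟨_, i₂⟩, ⟨_, i₁⟩, ⟨_, i₀⟩], fun i => by
      fin_cases i
      · exact (PrimeSpectrum.asIdeal_lt_asIdeal _ _).mp lt₀
      · exact (PrimeSpectrum.asIdeal_lt_asIdeal _ _).mp lt₁
      · exact (PrimeSpectrum.asIdeal_lt_asIdeal _ _).mp lt₂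
      · exact (PrimeSpectrum.asIdeal_lt_asIdeal _ _).mp lt₃⟩
  exact Order.LTSeries.length_le_krullDim c

/-- **The chart has topological Krull dimension `≥ 4`** (not `≤ 3`; a fortiori not `≤ 1`): the
topological dimension of `Spec` is the Krull dimension of the ring. [folklore] -/
theorem not_topologicalKrullDim_chart_le_three (h2 : (2 : K) ≠ 0) :
    ¬ topologicalKrullDim (Spec (.of (Localization.Away (Ideal.Quotient.mk (HuGamma.ideal K 4 {u | aeval (fun ij : Fin 3 × Fin 4 =>
          (![![(1 : K), 1, 1, 0], ![1, 1, 0, 1], ![1, 0, 1, 1]] : Fin 3 → Fin 4 → K) ij.1 ij.2)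
            (HuGamma.minor K 4 u) = 0}) (X (0, 0)))))) ≤ 3 := by
  intro h
  have h4 := four_le_ringKrullDim_chart (K := K) h2
  have hdim : topologicalKrullDim (Spec (.of (Localization.Away (Ideal.Quotient.mk (HuGamma.ideal K 4 {u | aeval (fun ij : Fin 3 × Fin 4 =>
          (![![(1 : K), 1, 1, 0], ![1, 1, 0, 1], ![1, 0, 1, 1]] : Fin 3 → Fin 4 → K) ij.1 ij.2)
            (HuGamma.minor K 4 u) = 0}) (X (0, 0)))))) = ringKrullDim (Localization.Away (Ideal.Quotient.mk (HuGamma.ideal K 4 {u | aeval (fun ij : Fin 3 × Fin 4 =>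
          (![![(1 : K), 1, 1, 0], ![1, 1, 0, 1], ![1, 0, 1, 1]] : Fin 3 → Fin 4 → K) ij.1 ij.2)
            (HuGamma.minor K 4 u) = 0}) (X (0, 0)))) := by
    change topologicalKrullDim (PrimeSpectrum (Localization.Away (Ideal.Quotient.mk (HuGamma.ideal K 4 {u | aeval (fun ij : Fin 3 × Fin 4 =>
          (![![(1 : K), 1, 1, 0], ![1, 1, 0, 1], ![1, 0, 1, 1]] : Fin 3 → Fin 4 → K) ij.1 ij.2)
            (HuGamma.minor K 4 u) = 0}) (X (0, 0))))) = _
    exact PrimeSpectrum.topologicalKrullDim_eq_ringKrullDim _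
  rw [hdim] at h
  have h43 := h4.trans h
  norm_num at h43

end Summit.ResolutionOfSingularities.ResolutionOfSingularities.Theorems.MatroidCellRes

end
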